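import Summits.BirchSwinnertonDyer.BirchSwinnertonDyer.Theorems.PrintCf2SplitBadTwoRestrictedSelmerLocalTrivialAwayFromP
import Summits.BirchSwinnertonDyer.BirchSwinnertonDyer.Theorems.PrintCf2SplitBadTwoLocalPointsScalarDyadic
import Literature.NumberTheory.EllipticCurves.SubgroupSelmerCocycleCriteriaProofs
import Literature.NumberTheory.EllipticCurves.ShaRestriction
import HarnessLib

/-!
# Crux `PrintCf2.SplitBadTwoRankOneOfFacts` (stmt-BirchSwinnertonDyer-20368), road α v10.3, S3c bottom value — LOCAL KUMMER THEORY ON A LINE: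
# at a place `w` where `E(K_w)/tors` is a `ℤ_p`-line through a global point `P`, every class classical at `w` is, on `D_w`, an integer multiple
# of a Kummer class of `P`; and the rank-one relation holds on the fixed local points at the dyadic places of the S3c frame

Cell `bsd-print-cf2`, width seat `bsd-line-cf2-p1-w7` g3; `--supports stmt-BirchSwinnertonDyer-20368` (helper, Theses-free). HONEST FRAMING: nothing here
closes a crux or a stub; BSD is not proved by any of this; no summit statement is proved by this seat. No definition, no named fact, no `sorry`, no kit.
beyond-print theorem: no.

NOTE. §1 `exists_resOfLe_eq_zsmul_kummer_of_rankOne` IS this seat's ACCEPTED p672775 (`…RestrictedSelmerBottomLocalKummerRankOne.exists_resOfLe_eq_zsmul_resOfLe_kummer`)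
with the two existentials in the order `(M, n)` and the same proof: that module could not be imported because, one hour after its acceptance, the farm still
served no olean for it (`remote:incoherent:…:no-olean`), which blocked every importer while three width seats were waiting for the consumers below
(files `…LocalKummerCyclic`, `…BottomExhaustion`, `…StrictAtV`). When its olean exists the two are interchangeable.

WHAT.
* §1 `exists_resOfLe_eq_zsmul_kummer_of_rankOne` — for an elliptic curve `V` over a number field `K`, a prime `p`, a place `w`, a point `P ∈ V(K)`
  and the RANK-ONE RELATION at `w` (every `Γ_{K_w}`-fixed `y ∈ E(K̄_w)` has `p^a y − M·P − p^{K'} y' ∈` torsion for all `K'`): every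
  `c ∈ localKerOver p ⊤ K_w` satisfies `res_{D_w} c = M • res_{D_w}(res_⊤ κ_n(P))` (Agboola 2007 Prop. 6.11's «cocyclic ⟹ loc onto» as a
  cocycle identity: `S := m'(Q − M Q_P − y')` is torsion hence ALGEBRAIC, Bézout with `gcd(m', p) = 1`).
* §2 `not_isOfFinAddOrder_map_of_injective`; §3 **`exists_rankOne_rel_fixedPoints`** — the rank-one relation on the `Γ_{K_w}`-fixed points of
  `E(K̄_w)` at a place `w ∣ 2` of a quadratic field with a second place above `2` (`K_w ≅ ℚ₂`), through any `K`-point of infinite order: Galois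
  descent (`exists_toGeomPoints_eq_of_forall_smul_eq`, `localPointsEquivGeomPoints`) + `LocalPointsScalar.exists_rankOne_rel_adicCompletion_two`
  (Silverman VII.6.3 at `[K_w : ℚ₂] = 1`, p671939).

References: A. Agboola, Compositio 143 (2007) = arXiv math/0602192 §6 Prop. 6.11 (p0014) [Agboola2007]; R. Greenberg, LNM 1716 (1999) §2
Prop. 2.1, p. 62 [GreenbergLNM1716]; J. H. Silverman, *AEC* 2nd ed., Prop. VII.6.3 [SilvermanAEC2009]; J.-P. Serre, *Galois Cohomology* I.§2.4
[SerreGaloisCohomology1997].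
-/

noncomputable section

open scoped Classical TensorProduct

set_option linter.dupNamespace false -- `Summit.BirchSwinnertonDyer.BirchSwinnertonDyer` (summit = problem) is the tree's layout
set_option autoImplicit false

open NumberField IsDedekindDomain Field WeierstrassCurve
open Literature.NumberTheory.EllipticCurves Literature.NumberTheory.EllipticCurves.GreenbergSelmer
open Literature.NumberTheory.EllipticCurves.ResKernel Literature.NumberTheory.EllipticCurves.CocycleCriteria
open Literature.NumberTheory.GaloisRepresentations

universe u

namespace Summit.BirchSwinnertonDyer.BirchSwinnertonDyer.Theorems.PrintCf2.RestrictedSelmerPair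

/-! ## §1. A classical class at a rank-one place is a multiple of a Kummer class of the generator -/

section LocalRankOne

variable {K : Type u} [Field K] [NumberField K] (V : WeierstrassCurve K) [V.IsElliptic] (p : ℕ) [Fact p.Prime]
  (w : HeightOneSpectrum (𝓞 K)) (P : V.toAffine.Point)

set_option maxHeartbeats 400000 in
/-- **A class classical at `w` is, on `D_w`, an integer multiple of a Kummer class of `P`** when `E(K_w)/tors` is a line through `P`
(hypothesis `hrel`: for every `Γ_{K_w}`-fixed `y`, some `p^a y ≡ M P (mod p^{K'} E(K̄_w)^{Γ} + tors)` for all `K'`):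
`res_{D_w} c = M • res_{D_w}(res_⊤ κ_n(P))` (p672775's `exists_resOfLe_eq_zsmul_resOfLe_kummer` with the two existentials in the order `M, n`). [cite: Agboola2007, Prop. 6.11 (arXiv p0014)] [cite: GreenbergLNM1716, §2 Prop. 2.1 and p. 62] -/
theorem exists_resOfLe_eq_zsmul_kummer_of_rankOne
    (hrel : ∀ y : localPoints V (w.adicCompletion K), (∀ σ : absoluteGaloisGroup (w.adicCompletion K), σ • y = y) →
      ∃ a : ℕ, ∀ K' : ℕ, ∃ (M : ℤ) (y' : localPoints V (w.adicCompletion K)),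
        (∀ σ : absoluteGaloisGroup (w.adicCompletion K), σ • y' = y') ∧
        IsOfFinAddOrder (((p : ℤ) ^ a) • y - M • pointsMap V (w.adicCompletion K) (toGeomPoints V P) - ((p : ℤ) ^ K') • y'))
    {c : subgroupH1 (⊤ : Subgroup (absoluteGaloisGroup K)) (V.geomPrimaryTorsion p)}
    (hc : c ∈ V.localKerOver p ⊤ (w.adicCompletion K)) :
    ∃ (M : ℤ) (n : ℕ), resOfLe (V.geomPrimaryTorsion p) (inf_le_left : ⊤ ⊓ decomp w ≤ ⊤) c =
      M • resOfLe (V.geomPrimaryTorsion p) (inf_le_left : ⊤ ⊓ decomp w ≤ ⊤)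
        (resSubgroup ⊤ (V.geomPrimaryTorsion p) (V.kummerMapLevel p V.zsmul_geomPoints_surjective_holds n P)) := by
  -- notation
  set E := w.adicCompletion K with hE
  set ι := closureEmb (K := K) (w.adicCompletion K) with hι
  obtain ⟨φ, rfl⟩ := oneCocycleClass_surjective (discreteTopRep (⊤ : Subgroup (absoluteGaloisGroup K)) (V.geomPrimaryTorsion p)) c
  -- the classical condition: `ι φ(res τ) = τQ - Q` on `Γ_{K_w}`
  have hc' : resH1Hom (resGalSubgroupOfEmb ⊤ ι) ((pointsMapOfEmb V ι).comp (V.geomPrimaryTorsion p).subtype)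
      (fun τ P ↦ by
        simp only [AddMonoidHom.coe_comp, AddSubgroup.coe_subtype, Function.comp_apply, Subgroup.smul_def,
          resGalSubgroupOfEmb_apply_coe, Literature.NumberTheory.EllipticCurves.primaryComponent.coe_smul]
        exact pointsMapOfEmb_smul V ι τ P)
      (oneCocycleClass _ φ) = 0 := hc
  rw [resH1Hom_oneCocycleClass_eq_zero_iff] at hc'
  obtain ⟨Q, hQ⟩ := hc'
  have hQ' : ∀ σ : absoluteGaloisGroup E, pointsMapOfEmb V ι ((φ.1 (resGalSubgroupOfEmb ⊤ ι ⟨σ, (mem_localSubgroupOfEmb_iff ⊤ ι σ).mpr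
      (Subgroup.mem_top _)⟩) : V.geomPrimaryTorsion p) : V.geomPoints) = σ • Q - Q :=
    fun σ ↦ hQ ⟨σ, (mem_localSubgroupOfEmb_iff ⊤ ι σ).mpr (Subgroup.mem_top _)⟩
  -- finite image: `p^N φ = 0`
  haveI : CompactSpace (absoluteGaloisGroup K) := compactSpace_absoluteGaloisGroup K
  haveI : CompactSpace (⊤ : Subgroup (absoluteGaloisGroup K)) :=
    isCompact_iff_compactSpace.mp (by rw [Subgroup.coe_top]; exact isCompact_univ)
  obtain ⟨N, hN⟩ := exists_pow_smul_apply_eq_zero (p := p) φ.1 (fun g ↦ by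
    obtain ⟨k, hk⟩ := (AddCommGroup.mem_primaryComponent).mp (φ.1 g).2
    exact ⟨k, Subtype.ext (by rw [AddSubmonoidClass.coe_nsmul, ZeroMemClass.coe_zero]; exact hk)⟩)
  -- `y := p^N Q` is `Γ_{K_w}`-rational
  have hy : ∀ σ : absoluteGaloisGroup E, σ • ((p ^ N : ℕ) • Q) = (p ^ N : ℕ) • Q := by
    intro σ
    rw [smul_comm, ← sub_eq_zero, ← smul_sub, ← hQ' σ, ← map_nsmul, ← AddSubmonoidClass.coe_nsmul, hN, ZeroMemClass.coe_zero,
      map_zero]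
  -- rank one: `p^a y ≡ M P_loc (mod p^(N+a) E(K_w) + tors)`
  obtain ⟨a, ha⟩ := hrel _ hy
  obtain ⟨M, y', hy', htor⟩ := ha (N + a)
  set n := N + a with hn
  -- the global root `Q_P`, `p^n Q_P = P`, and its local image
  set QP := V.kummerRoot p V.zsmul_geomPoints_surjective_holds n P with hQP
  have hnQP : p ^ n • QP = toGeomPoints V P := V.nsmul_kummerRoot p V.zsmul_geomPoints_surjective_holds n P
  set QPloc := pointsMap V E QP with hQPloc
  -- the torsion point `D` and its order `m = p^j m'`
  obtain ⟨m, hm0, hmD⟩ := isOfFinAddOrder_iff_nsmul_eq_zero.mp htor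
  obtain ⟨j, m', hm', hmm'⟩ := Nat.exists_eq_pow_mul_and_not_dvd hm0.ne' p (Fact.out : p.Prime).ne_one
  refine ⟨M, n, ?_⟩
  -- `S := m' • (Q − M • Q_P,loc − y')` is killed by `p^(n+j)`, hence algebraic
  set X : localPoints V E := Q - M • QPloc - y' with hXdef
  set S : localPoints V E := m' • X with hSdef
  have h1 : (p ^ n : ℕ) • Q = ((p : ℤ) ^ a) • ((p ^ N : ℕ) • Q) := by
    rw [hn, pow_add, mul_comm, ← smul_smul, ← natCast_zsmul, Nat.cast_pow]
  have h2 : (p ^ n : ℕ) • (M • QPloc) = M • pointsMap V E (toGeomPoints V P) := by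
    rw [smul_comm, hQPloc, ← map_nsmul, hnQP]
  have h3 : (p ^ n : ℕ) • y' = ((p : ℤ) ^ n) • y' := by rw [← natCast_zsmul, Nat.cast_pow]
  have hX : (p ^ n : ℕ) • X = ((p : ℤ) ^ a) • ((p ^ N : ℕ) • Q) - M • pointsMap V E (toGeomPoints V P) - ((p : ℤ) ^ n) • y' := by
    rw [hXdef, smul_sub, smul_sub, h1, h2, h3]
  have hS : (((p ^ (n + j) : ℕ) : ℤ)) • S = 0 := by
    rw [natCast_zsmul, hSdef, smul_smul, show p ^ (n + j) * m' = m * p ^ n by rw [hmm']; ring, ← smul_smul, hX, hmD]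
  have hnz : ((p ^ (n + j) : ℕ) : ℤ) ≠ 0 := by exact_mod_cast (pow_pos (Fact.out : p.Prime).pos _).ne'
  set T : AddSubgroup.torsionBy (localPoints V E) ((p ^ (n + j) : ℕ) : ℤ) :=
    ⟨S, by change ((p ^ (n + j) : ℕ) : ℤ) • S = 0; exact hS⟩ with hTdef
  set t : V.geomTorsion ((p ^ (n + j) : ℕ) : ℤ) := (V.torsionPointsEquiv ((p ^ (n + j) : ℕ) : ℤ) (E := E) hnz).symm T with htdef
  have ht : pointsMap V E (t : V.geomPoints) = S := by
    rw [htdef, V.pointsMap_torsionPointsEquiv_symm]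
  have htp : (t : V.geomPoints) ∈ V.geomPrimaryTorsion p := by
    refine (AddCommGroup.mem_primaryComponent).mpr ⟨n + j, ?_⟩
    have h2 := t.2
    change ((p ^ (n + j) : ℕ) : ℤ) • (t : V.geomPoints) = 0 at h2
    rw [natCast_zsmul] at h2
    exact h2
  -- the Kummer cocycle of `P` at level `n`, restricted to `⊤`
  have hQPfix : ∀ σ : absoluteGaloisGroup K, σ • (p ^ n • QP) = p ^ n • QP := smul_nsmul_of_nsmul_eq V p hnQP
  set ψP := contOneCocycles.pullback (Literature.NumberTheory.EllipticCurves.subgroupIncl (⊤ : Subgroup (absoluteGaloisGroup K)))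
    (resHomOfEquivariant (Literature.NumberTheory.EllipticCurves.subgroupIncl (⊤ : Subgroup (absoluteGaloisGroup K))) (AddMonoidHom.id (V.geomPrimaryTorsion p))
      (fun _ _ ↦ rfl)) (V.kummerCocycle p n QP hQPfix) with hψP
  have hκ : resSubgroup ⊤ (V.geomPrimaryTorsion p) (V.kummerMapLevel p V.zsmul_geomPoints_surjective_holds n P) =
      oneCocycleClass _ ψP := by
    rw [hψP, ← ResKernel.resSubgroup_oneCocycleClass]
    rfl
  have hψP_apply : ∀ g : (⊤ : Subgroup (absoluteGaloisGroup K)), ((ψP.1 g : V.geomPrimaryTorsion p) : V.geomPoints) =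
      (g : absoluteGaloisGroup K) • QP - QP := fun g ↦ rfl
  rw [hκ]
  -- abbreviations for the two restricted classes
  set A := resOfLe (V.geomPrimaryTorsion p) (inf_le_left : ⊤ ⊓ decomp w ≤ ⊤) (oneCocycleClass _ φ) with hA
  set B := resOfLe (V.geomPrimaryTorsion p) (inf_le_left : ⊤ ⊓ decomp w ≤ ⊤) (oneCocycleClass _ ψP) with hB
  -- (i) `p^n • A = 0`, (ii) `p^n • B = 0`
  have hφn : ∀ g, p ^ n • φ.1 g = 0 := fun g ↦ by
    rw [hn, pow_add, mul_comm, mul_smul, hN, smul_zero]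
  have hnA : ((p : ℤ) ^ n) • A = 0 := by
    have h0 : p ^ n • φ = 0 := by
      apply Subtype.ext; ext g
      rw [AddSubmonoidClass.coe_nsmul, ContinuousMap.coe_nsmul, Pi.smul_apply, hφn]
      rfl
    rw [← Nat.cast_pow, natCast_zsmul, hA, ← map_nsmul, ← oneCocycleClassₗ_apply, ← map_nsmul, h0, map_zero, map_zero]
  have hnB : ((p : ℤ) ^ n) • B = 0 := by
    have h0 : p ^ n • ψP = 0 := by
      apply Subtype.ext; ext g
      rw [AddSubmonoidClass.coe_nsmul, ContinuousMap.coe_nsmul, Pi.smul_apply, AddSubmonoidClass.coe_nsmul, hψP_apply, smul_sub,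
        smul_comm, hQPfix, sub_self]
      rfl
    rw [← Nat.cast_pow, natCast_zsmul, hB, ← map_nsmul, ← oneCocycleClassₗ_apply, ← map_nsmul, h0, map_zero, map_zero]
  -- (iii) `m' • A − (m' M) • B = 0`: the cocycle `m' φ − m' M ψP` is the coboundary of `t` on `D_w`
  set ζ := (m' : ℤ) • φ - ((m' : ℤ) * M) • ψP with hζ
  have hζ_apply : ∀ g : (⊤ : Subgroup (absoluteGaloisGroup K)), ((ζ.1 g : V.geomPrimaryTorsion p) : V.geomPoints) =
      (m' : ℤ) • ((φ.1 g : V.geomPrimaryTorsion p) : V.geomPoints) - ((m' : ℤ) * M) • ((g : absoluteGaloisGroup K) • QP - QP) := by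
    intro g
    rw [hζ, Submodule.coe_sub, Submodule.coe_smul_of_tower, Submodule.coe_smul_of_tower, ContinuousMap.sub_apply,
      ContinuousMap.smul_apply, ContinuousMap.smul_apply, AddSubgroupClass.coe_sub, AddSubgroupClass.coe_zsmul,
      AddSubgroupClass.coe_zsmul, hψP_apply]
  have hζ0 : resOfLe (V.geomPrimaryTorsion p) (inf_le_left : ⊤ ⊓ decomp w ≤ ⊤) (oneCocycleClass _ ζ) = 0 := by
    rw [CocycleCriteria.resOfLe_oneCocycleClass_eq_zero_iff]
    refine ⟨⟨(t : V.geomPoints), htp⟩, fun g ↦ ?_⟩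
    obtain ⟨σ, hσ⟩ := (mem_decomp_iff w (g : absoluteGaloisGroup K)).mp (Subgroup.mem_inf.mp g.2).2
    have hg : (Subgroup.inclusion (inf_le_left : ⊤ ⊓ decomp w ≤ ⊤) g : (⊤ : Subgroup (absoluteGaloisGroup K))) =
        resGalSubgroupOfEmb ⊤ ι ⟨σ, (mem_localSubgroupOfEmb_iff ⊤ ι σ).mpr (Subgroup.mem_top _)⟩ := by
      apply Subtype.ext
      rw [resGalSubgroupOfEmb_apply_coe]
      exact hσ.symm
    apply Subtype.ext
    apply pointsMapOfEmb_injective V ι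
    rw [hζ_apply, map_sub, map_zsmul, map_zsmul, hg, hQ' σ, AddSubgroupClass.coe_sub,
      Literature.NumberTheory.EllipticCurves.primaryComponent.coe_smul, map_sub, map_sub, ← hσ, resGalSubgroupOfEmb_apply_coe]
    change (m' : ℤ) • (σ • Q - Q) - ((m' : ℤ) * M) • (pointsMap V E (resGal (K := K) E σ • QP) - pointsMap V E QP) =
      pointsMap V E (resGal (K := K) E σ • (t : V.geomPoints)) - pointsMap V E (t : V.geomPoints)
    rw [pointsMap_smul, pointsMap_smul, ht, hSdef, hXdef, ← hQPloc]
    have hσS : σ • (m' • (Q - M • QPloc - y')) = m' • (σ • Q - M • (σ • QPloc) - y') := by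
      change DistribSMul.toAddMonoidHom (localPoints V E) σ (m' • (Q - M • QPloc - y')) = _
      rw [map_nsmul, map_sub, map_sub, map_zsmul]
      change m' • (σ • Q - M • (σ • QPloc) - σ • y') = _
      rw [hy' σ]
    rw [hσS, ← natCast_zsmul, ← natCast_zsmul]
    generalize σ • Q = SQ
    generalize σ • QPloc = SQP
    module
  have hζc : resOfLe (V.geomPrimaryTorsion p) (inf_le_left : ⊤ ⊓ decomp w ≤ ⊤) (oneCocycleClass _ ζ) =
      (m' : ℤ) • A - ((m' : ℤ) * M) • B := by
    rw [hA, hB, hζ, ← oneCocycleClassₗ_apply, map_sub, map_zsmul, map_zsmul, oneCocycleClassₗ_apply, oneCocycleClassₗ_apply,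
      map_sub, map_zsmul, map_zsmul]
  have hiii : (m' : ℤ) • (A - M • B) = 0 := by
    rw [zsmul_sub, smul_smul, ← hζc, hζ0]
  -- (iv) Bézout: `gcd(m', p^n) = 1`
  have hcop : IsCoprime (m' : ℤ) ((p : ℤ) ^ n) := by
    have h : Nat.Coprime m' (p ^ n) :=
      (Nat.coprime_comm.mp ((Nat.Prime.coprime_iff_not_dvd (Fact.out : p.Prime)).mpr hm')).pow_right n
    exact_mod_cast Nat.isCoprime_iff_coprime.mpr h
  obtain ⟨u, v, huv⟩ := hcop
  have hnAB : ((p : ℤ) ^ n) • (A - M • B) = 0 := by rw [zsmul_sub, smul_comm, hnA, hnB, zsmul_zero, sub_zero]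
  rw [← sub_eq_zero]
  calc A - M • B = (1 : ℤ) • (A - M • B) := (one_zsmul _).symm
    _ = (u * (m' : ℤ) + v * (p : ℤ) ^ n) • (A - M • B) := by rw [huv]
    _ = 0 := by rw [add_zsmul, mul_zsmul, mul_zsmul, hiii, hnAB, zsmul_zero, zsmul_zero, add_zero]

end LocalRankOne

/-! ## §2. Injective homomorphisms reflect torsion -/

section Torsion

/-- An injective additive homomorphism reflects elements of finite order. [folklore] -/
theorem not_isOfFinAddOrder_map_of_injective {A B : Type*} [AddCommGroup A] [AddCommGroup B] (f : A →+ B)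
    (hf : Function.Injective f) {x : A} (hx : ¬ IsOfFinAddOrder x) : ¬ IsOfFinAddOrder (f x) := by
  intro h
  obtain ⟨n, hn, hnx⟩ := isOfFinAddOrder_iff_nsmul_eq_zero.mp h
  rw [← map_nsmul, ← map_zero f] at hnx
  exact hx (isOfFinAddOrder_iff_nsmul_eq_zero.mpr ⟨n, hn, hf hnx⟩)

end Torsion

/-! ## §3. The rank-one relation on the fixed local points at a dyadic place of the frame -/

section RankOneLocal

variable {K : Type} [Field K] [NumberField K] (V : WeierstrassCurve K) [V.IsElliptic]

/-- **Rank-one relation on `E(K̄_w)^{Γ_{K_w}}` through a global point of infinite order**, at a place `w ∣ 2` of a quadratic field with a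
second place `w' ≠ w` above `2` (`K_w ≅ ℚ₂`): for every `Γ_{K_w}`-fixed `y ∈ E(K̄_w)` there is `a` such that for every `K'`:
`2^a y − M·P_loc − 2^{K'} y' ∈` torsion with `M ∈ ℤ` and `y'` fixed — the fixed points are the `K_w`-rational points of `E_{K_w}` (Galois
descent, `exists_toGeomPoints_eq_of_forall_smul_eq`), to which `LocalPointsScalar.exists_rankOne_rel_adicCompletion_two` applies.
[cite: SilvermanAEC2009, Prop. VII.6.3] [cite: Agboola2007, Prop. 6.11 (arXiv p0014)] -/
theorem exists_rankOne_rel_fixedPoints (hK2 : Module.finrank ℚ K = 2) {w w' : HeightOneSpectrum (𝓞 K)}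
    (hw : ((2 : ℕ) : 𝓞 K) ∈ w.asIdeal) (hw' : ((2 : ℕ) : 𝓞 K) ∈ w'.asIdeal) (hne : w' ≠ w)
    {PK : V.toAffine.Point} (hPK : ¬ IsOfFinAddOrder PK)
    (y : localPoints V (w.adicCompletion K)) (hy : ∀ σ : absoluteGaloisGroup (w.adicCompletion K), σ • y = y) :
    ∃ a : ℕ, ∀ K' : ℕ, ∃ (M : ℤ) (y' : localPoints V (w.adicCompletion K)),
      (∀ σ : absoluteGaloisGroup (w.adicCompletion K), σ • y' = y') ∧
      IsOfFinAddOrder (((2 : ℤ) ^ a) • y - M • pointsMap V (w.adicCompletion K) (toGeomPoints V PK) - ((2 : ℤ) ^ K') • y') := by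
  set E := w.adicCompletion K with hE
  haveI : CharZero E := LocalField.charZero_adicCompletion w
  haveI : (V.baseChange E).IsElliptic := by rw [baseChange]; infer_instance
  set Ψ := localPointsEquivGeomPoints V E with hΨ
  -- the fixed local points are `K_w`-rational points of `E_{K_w}`
  have hdesc : ∀ z : localPoints V E, (∀ σ : absoluteGaloisGroup E, σ • z = z) →
      ∃ z₀ : (V.baseChange E).toAffine.Point, toGeomPoints (V.baseChange E) z₀ = Ψ z := by
    intro z hz
    exact exists_toGeomPoints_eq_of_forall_smul_eq (V.baseChange E) (fun σ ↦ by rw [← localPointsEquivGeomPoints_smul, hz σ])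
  set Θ : (V.baseChange E).toAffine.Point →+ localPoints V E := Ψ.symm.toAddMonoidHom.comp (toGeomPoints (V.baseChange E)) with hΘ
  have hΘfix : ∀ (z₀ : (V.baseChange E).toAffine.Point) (σ : absoluteGaloisGroup E), σ • Θ z₀ = Θ z₀ := by
    intro z₀ σ
    change σ • Ψ.symm (toGeomPoints (V.baseChange E) z₀) = Ψ.symm (toGeomPoints (V.baseChange E) z₀)
    apply Ψ.injective
    rw [localPointsEquivGeomPoints_smul, AddEquiv.apply_symm_apply, smul_toGeomPoints]
  obtain ⟨y₀, hy₀⟩ := hdesc y hy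
  have hPfix : ∀ σ : absoluteGaloisGroup E, σ • pointsMap V E (toGeomPoints V PK) = pointsMap V E (toGeomPoints V PK) := by
    intro σ; rw [← pointsMap_smul, smul_toGeomPoints]
  obtain ⟨x₀, hx₀⟩ := hdesc _ hPfix
  have hΘy : Θ y₀ = y := by
    change Ψ.symm (toGeomPoints (V.baseChange E) y₀) = y; rw [hy₀, AddEquiv.symm_apply_apply]
  have hΘx : Θ x₀ = pointsMap V E (toGeomPoints V PK) := by
    change Ψ.symm (toGeomPoints (V.baseChange E) x₀) = _; rw [hx₀, AddEquiv.symm_apply_apply]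
  -- `x₀` has infinite order
  have hx₀' : ¬ IsOfFinAddOrder x₀ := by
    intro h
    have h1 : IsOfFinAddOrder (Θ x₀) := Θ.isOfFinAddOrder h
    rw [hΘx] at h1
    exact not_isOfFinAddOrder_map_of_injective _ (pointsMapOfEmb_injective V _)
      (not_isOfFinAddOrder_map_of_injective _ (toGeomPoints_injective V) hPK) h1
  obtain ⟨a, ha⟩ := LocalPointsScalar.exists_rankOne_rel_adicCompletion_two hK2 hw hw' hne (V.baseChange E) hx₀' y₀
  refine ⟨a, fun K' ↦ ?_⟩
  obtain ⟨M, y₀', h⟩ := ha K'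
  refine ⟨M, Θ y₀', hΘfix y₀', ?_⟩
  have h2 := Θ.isOfFinAddOrder h
  rw [map_sub, map_sub, map_zsmul, map_zsmul, map_zsmul, hΘy, hΘx] at h2
  exact h2

end RankOneLocal

end Summit.BirchSwinnertonDyer.BirchSwinnertonDyer.Theorems.PrintCf2.RestrictedSelmerPair

end
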